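import Summits.RiemannHypothesis.RiemannHypothesis.Theorems.SignConeExactConeRigidityCaratheodoryDirichlet
import Summits.RiemannHypothesis.RiemannHypothesis.Theorems.SignConeExactConeRigidityKRH

/-!
# Route SignCone, item `ExactConeRigidity` (stmt-RiemannHypothesis-16306): the DIAGONAL COMB INEQUALITIES of a
cone weight (the `c`-free starting point of the resonator passage)

Let `c ≥ 0` be `κ`-slack feasible against every Weil test (`κ = 0`: exact cone, this item; `κ = 1`: unit slack,
crux `ConeMagnification`).  Test it against a MULTIPLICATIVE COMB `g = Σ_{k ∈ S} a_k φ(· − log k)` with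
NONNEGATIVE coefficients `a_k ≥ 0` and a NONNEGATIVE real bump `φ = ψ ≥ 0`.  Then `G = g ⋆ g̃ =
Σ_{k,k′} a_k a_{k′} Φ(· − log(k/k′))`, `Φ = φ ⋆ φ̃ ≥ 0`, so every term of the fake prime sum
`P_c(G) = Σ_n c(n) n^{-1/2} (G(log n) + G(−log n))` is `≥ 0`, and keeping only the EXACTLY DIAGONAL pairs
`k = n k′` (where `Φ` is evaluated at `0`) gives, for every finite set `T` of nodes,

  `2 Φ(0) Σ_{n ∈ T} c(n) n^{-1/2} Σ_{k = n k′ ∈ S} a_k a_{k′} ≤ Re W_ar(G) + κ ‖g‖₂²`      (`slackWeight_comb_diag_le`)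

with a right-hand side that does NOT involve `c` (archimedean + polar part of the comb, explicit).  This is the
inequality family from which the type / torus inequalities of the 2001 programme are extracted by evaluating
the right side for `a = α ⋆ (m ↦ m^{-1/2} 𝟙_{m ≤ M})` (see the item's evidence note RIGIDITY-ANALYSIS.md §6):
the unknown weight enters only diagonally, the near-diagonal terms having been discarded by positivity.

* `re_weilConv_weilReflect_ofReal_nonneg`, `re_comb_autocorrelation`, `re_comb_autocorrelation_nonneg`,
  `diag_le_re_comb_autocorrelation` — the comb bookkeeping;
* `slackWeight_comb_diag_le` — the inequality for `κ`-slack weights; `exactWeight_comb_diag_le` (`κ = 0`),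
  `unitSlackWeight_comb_diag_le` (`κ = 1`).
-/

noncomputable section

-- `Summit.RiemannHypothesis.RiemannHypothesis.…` repeats a namespace component by design (D-0017 layout).
set_option linter.dupNamespace false

open scoped BigOperators ComplexConjugate Real Topology
open Complex MeasureTheory Set Filter Finset

namespace Summit.RiemannHypothesis.RiemannHypothesis.Theorems.SignConeExactConeRigidity

open Literature.NumberTheory.LFunctions
open Summit.RiemannHypothesis.RiemannHypothesis.Theorems.SignCone
open Summit.RiemannHypothesis.RiemannHypothesis.Theorems.SignConeConeMagnification
open Summit.RiemannHypothesis.RiemannHypothesis.Theorems.RuelleBandCofiniteCriticalLine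

variable {c : ℕ → ℝ} {κ : ℝ}

/-! ## Comb bookkeeping -/

/-- The autocorrelation `Φ = φ ⋆ φ̃` of a nonnegative real bump `φ = ψ ≥ 0` has nonnegative real part:
`Re Φ(t) = ∫ ψ(u) ψ(u − t) du ≥ 0`. -/
theorem re_weilConv_weilReflect_ofReal_nonneg {ψ : ℝ → ℝ} (hψ0 : ∀ t, 0 ≤ ψ t) (t : ℝ) :
    0 ≤ (weilConv (fun u => (ψ u : ℂ)) (weilReflect fun u => (ψ u : ℂ)) t).re := by
  rw [weilConv_weilReflect_eq_integral_conj]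
  have e : (fun u : ℝ => ((ψ u : ℝ) : ℂ) * conj ((ψ (u - t) : ℝ) : ℂ)) =
      fun u : ℝ => ((ψ u * ψ (u - t) : ℝ) : ℂ) := by
    funext u
    rw [Complex.conj_ofReal, Complex.ofReal_mul]
  rw [e, integral_complex_ofReal, Complex.ofReal_re]
  exact integral_nonneg fun u => mul_nonneg (hψ0 u) (hψ0 _)

/-- Real part of the autocorrelation of a comb with real coefficients:
`Re G(t) = Σ_{(k,k′) ∈ S × S} a_k a_{k′} Re Φ(t − (log k − log k′))`. -/
theorem re_comb_autocorrelation {φ : ℝ → ℂ} (hφ : IsWeilTest φ) (S : Finset ℕ) (a : ℕ → ℝ)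
    {g : ℝ → ℂ} (hg : g = fun t => ∑ k ∈ S, (a k : ℂ) * weilTranslate φ (Real.log k) t) (t : ℝ) :
    (weilConv g (weilReflect g) t).re =
      ∑ p ∈ S ×ˢ S, a p.1 * a p.2 *
        (weilConv φ (weilReflect φ) (t - (Real.log p.1 - Real.log p.2))).re := by
  rw [hg, weilConv_weilReflect_comb_translate hφ S (fun k => (a k : ℂ)) (fun k => Real.log k)]
  simp only
  rw [Complex.re_sum]
  refine Finset.sum_congr rfl fun p _ => ?_
  rw [Complex.conj_ofReal, ← Complex.ofReal_mul, Complex.re_ofReal_mul]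
  rfl

/-- The autocorrelation of a nonnegative comb of a nonnegative real bump has nonnegative real part. -/
theorem re_comb_autocorrelation_nonneg {ψ : ℝ → ℝ} (hψ : IsWeilTest fun u => (ψ u : ℂ))
    (hψ0 : ∀ t, 0 ≤ ψ t) (S : Finset ℕ) {a : ℕ → ℝ} (ha : ∀ k, 0 ≤ a k)
    {g : ℝ → ℂ} (hg : g = fun t => ∑ k ∈ S, (a k : ℂ) * weilTranslate (fun u => (ψ u : ℂ)) (Real.log k) t)
    (t : ℝ) : 0 ≤ (weilConv g (weilReflect g) t).re := by
  rw [re_comb_autocorrelation hψ S a hg]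
  exact Finset.sum_nonneg fun p _ =>
    mul_nonneg (mul_nonneg (ha _) (ha _)) (re_weilConv_weilReflect_ofReal_nonneg hψ0 _)

/-- **Diagonal extraction.** For a nonnegative comb of a nonnegative real bump and a node `n ≥ 1`,
`Re Φ(0) · Σ_{(k,k′) ∈ S×S, k = n k′} a_k a_{k′} ≤ Re G(log n)`: keep the exactly diagonal pairs (there the
argument of `Φ` is `log n − log k + log k′ = 0`) and drop the others, all of which are `≥ 0`. -/
theorem diag_le_re_comb_autocorrelation {ψ : ℝ → ℝ} (hψ : IsWeilTest fun u => (ψ u : ℂ))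
    (hψ0 : ∀ t, 0 ≤ ψ t) (S : Finset ℕ) (hS : ∀ k ∈ S, 0 < k) {a : ℕ → ℝ} (ha : ∀ k, 0 ≤ a k)
    {g : ℝ → ℂ} (hg : g = fun t => ∑ k ∈ S, (a k : ℂ) * weilTranslate (fun u => (ψ u : ℂ)) (Real.log k) t)
    {n : ℕ} (hn : 0 < n) :
    (weilConv (fun u => (ψ u : ℂ)) (weilReflect fun u => (ψ u : ℂ)) 0).re *
        ∑ p ∈ (S ×ˢ S).filter (fun p => p.1 = n * p.2), a p.1 * a p.2 ≤
      (weilConv g (weilReflect g) (Real.log n)).re := by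
  rw [re_comb_autocorrelation hψ S a hg, Finset.mul_sum]
  have hsub : (S ×ˢ S).filter (fun p => p.1 = n * p.2) ⊆ S ×ˢ S := Finset.filter_subset _ _
  refine le_trans (le_of_eq ?_) (Finset.sum_le_sum_of_subset_of_nonneg hsub fun p _ _ =>
    mul_nonneg (mul_nonneg (ha _) (ha _)) (re_weilConv_weilReflect_ofReal_nonneg hψ0 _))
  refine Finset.sum_congr rfl fun p hp => ?_
  obtain ⟨hpS, hpn⟩ := Finset.mem_filter.1 hp
  have hp2 : 0 < p.2 := hS _ (Finset.mem_product.1 hpS).2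
  have hlog : Real.log n - (Real.log p.1 - Real.log p.2) = 0 := by
    rw [hpn, Nat.cast_mul, Real.log_mul (by exact_mod_cast hn.ne') (by exact_mod_cast hp2.ne')]
    ring
  rw [hlog]
  ring

/-! ## The diagonal comb inequality -/

/-- **The diagonal comb inequalities of a `κ`-slack cone weight.**  Let `c ≥ 0` satisfy
`−κ‖φ‖₂² ≤ Re (W_ar − P_c)(φ ⋆ φ̃)` for every Weil test `φ`.  For a nonnegative real Weil bump `ψ`, a finite
set `S` of positive integers with nonnegative coefficients `a`, the comb `g = Σ_{k∈S} a_k ψ(· − log k)` and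
`G = g ⋆ g̃`, and every finite set `T` of positive nodes:
`2 Re Φ(0) · Σ_{n∈T} c(n) n^{-1/2} Σ_{(k,k′)∈S×S, k = nk′} a_k a_{k′} ≤ Re (W_polar + W_arch)(G) + κ‖g‖₂²`
(`Φ = ψ ⋆ ψ̃`; the right side does not involve `c`).  Proof: feasibility for `g`; the fake prime sum of `G`
is a finite sum of nonnegative terms (`Re G ≥ 0`, hermitian symmetry `Re G(−t) = Re G(t)`); keep the nodes of
`T` and, inside each, the diagonal pairs (`diag_le_re_comb_autocorrelation`). -/
theorem slackWeight_comb_diag_le (hc : ∀ n, 0 ≤ c n)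
    (hUκ : ∀ φ : ℝ → ℂ, IsWeilTest φ →
      -(κ * ∫ t, ‖φ t‖ ^ 2) ≤
        (weilPolarTerm (weilConv φ (weilReflect φ)) + weilArchTerm (weilConv φ (weilReflect φ)) -
          ∑' n : ℕ, ((c n : ℝ) : ℂ) / (Real.sqrt n : ℂ) *
            (weilConv φ (weilReflect φ) (Real.log n) + weilConv φ (weilReflect φ) (-Real.log n))).re)
    {ψ : ℝ → ℝ} (hψ : IsWeilTest fun u => (ψ u : ℂ)) (hψ0 : ∀ t, 0 ≤ ψ t)
    (S : Finset ℕ) (hS : ∀ k ∈ S, 0 < k) {a : ℕ → ℝ} (ha : ∀ k, 0 ≤ a k)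
    {g : ℝ → ℂ} (hg : g = fun t => ∑ k ∈ S, (a k : ℂ) * weilTranslate (fun u => (ψ u : ℂ)) (Real.log k) t)
    (T : Finset ℕ) (hT : ∀ n ∈ T, 0 < n) :
    2 * (weilConv (fun u => (ψ u : ℂ)) (weilReflect fun u => (ψ u : ℂ)) 0).re *
        ∑ n ∈ T, c n / Real.sqrt n * ∑ p ∈ (S ×ˢ S).filter (fun p => p.1 = n * p.2), a p.1 * a p.2 ≤
      (weilPolarTerm (weilConv g (weilReflect g)) + weilArchTerm (weilConv g (weilReflect g))).re +
        κ * ∫ t, ‖g t‖ ^ 2 := by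
  set G : ℝ → ℂ := weilConv g (weilReflect g) with hGdef
  have hgt : IsWeilTest g := by
    rw [hg]
    exact stub_branchesContinuous_isWeilTest_comb S _ fun k _ => hψ.weilTranslate _
  -- the fake prime sum of `G` is a finite sum: a window for `g`
  obtain ⟨R, hR⟩ := hgt.2.isCompact.isBounded.subset_closedBall 0
  set A : ℝ := max R 1 with hA
  have hsupp : tsupport g ⊆ Icc (-A) A := by
    refine hR.trans ?_
    rw [Real.closedBall_eq_Icc, zero_sub, zero_add]
    exact Icc_subset_Icc (neg_le_neg (le_max_left _ _)) (le_max_left _ _)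
  set N : ℕ := ⌈Real.exp (2 * A)⌉₊ + 1 with hN
  set f : ℕ → ℂ := fun n => ((c n : ℝ) : ℂ) / (Real.sqrt n : ℂ) * (G (Real.log n) + G (-Real.log n)) with hf
  have hzero : ∀ n : ℕ, N ≤ n → f n = 0 := by
    intro n hn
    have hn1 : Real.exp (2 * A) < n := by
      have h1 : Real.exp (2 * A) ≤ ⌈Real.exp (2 * A)⌉₊ := Nat.le_ceil _
      have h2 : ((⌈Real.exp (2 * A)⌉₊ : ℕ) : ℝ) + 1 ≤ n := by exact_mod_cast hn
      linarith
    have hnpos : (0 : ℝ) < n := (Real.exp_pos _).trans hn1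
    have hlog : 2 * A ≤ Real.log n := by
      rw [Real.le_log_iff_exp_le hnpos]
      exact hn1.le
    have hA0 : 0 ≤ 2 * A := by linarith [le_max_right R 1]
    have h1 : G (Real.log n) = 0 :=
      weilConv_weilReflect_eq_zero_of_le_abs hgt hsupp (by rwa [abs_of_nonneg (hA0.trans hlog)])
    have h2 : G (-Real.log n) = 0 :=
      weilConv_weilReflect_eq_zero_of_le_abs hgt hsupp (by rwa [abs_neg, abs_of_nonneg (hA0.trans hlog)])
    simp only [hf, h1, h2, add_zero, mul_zero]
  set U : Finset ℕ := Finset.range N ∪ T with hU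
  have htsum : (∑' n : ℕ, f n) = ∑ n ∈ U, f n := by
    refine tsum_eq_sum fun n hn => hzero n ?_
    by_contra hlt
    exact hn (Finset.mem_union_left _ (Finset.mem_range.2 (not_le.1 hlt)))
  -- real parts of the terms
  have hGre_nonneg : ∀ t, 0 ≤ (G t).re := fun t => re_comb_autocorrelation_nonneg hψ hψ0 S ha hg t
  have hGsym : ∀ t, (G (-t)).re = (G t).re := by
    intro t
    have h := congrArg Complex.re (conj_weilConv_weilReflect_neg g t)
    rwa [Complex.conj_re] at h
  have hfre : ∀ n : ℕ, (f n).re = c n / Real.sqrt n * (2 * (G (Real.log n)).re) := by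
    intro n
    simp only [hf]
    rw [show ((c n : ℝ) : ℂ) / (Real.sqrt n : ℂ) = ((c n / Real.sqrt n : ℝ) : ℂ) by push_cast; rfl,
      Complex.re_ofReal_mul, Complex.add_re, hGsym]
    ring
  have hfre_nonneg : ∀ n : ℕ, 0 ≤ (f n).re := by
    intro n
    rw [hfre]
    exact mul_nonneg (div_nonneg (hc n) (Real.sqrt_nonneg _))
      (mul_nonneg zero_le_two (hGre_nonneg _))
  -- feasibility for the comb
  have hfeas := hUκ g hgt
  change -(κ * ∫ t, ‖g t‖ ^ 2) ≤ (weilPolarTerm G + weilArchTerm G - ∑' n : ℕ, f n).re at hfeas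
  rw [Complex.sub_re, htsum, Complex.re_sum] at hfeas
  -- the diagonal lower bound, node by node
  have hnode : ∀ n ∈ T, 2 * (weilConv (fun u => (ψ u : ℂ)) (weilReflect fun u => (ψ u : ℂ)) 0).re *
      (c n / Real.sqrt n * ∑ p ∈ (S ×ˢ S).filter (fun p => p.1 = n * p.2), a p.1 * a p.2) ≤ (f n).re := by
    intro n hn
    rw [hfre]
    have hd := diag_le_re_comb_autocorrelation hψ hψ0 S hS ha hg (hT n hn)
    have hcn : 0 ≤ c n / Real.sqrt n := div_nonneg (hc n) (Real.sqrt_nonneg _)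
    nlinarith
  have hsumT : 2 * (weilConv (fun u => (ψ u : ℂ)) (weilReflect fun u => (ψ u : ℂ)) 0).re *
      ∑ n ∈ T, c n / Real.sqrt n * ∑ p ∈ (S ×ˢ S).filter (fun p => p.1 = n * p.2), a p.1 * a p.2 ≤
      ∑ n ∈ T, (f n).re := by
    rw [Finset.mul_sum]
    exact Finset.sum_le_sum hnode
  have hTU : ∑ n ∈ T, (f n).re ≤ ∑ n ∈ U, (f n).re :=
    Finset.sum_le_sum_of_subset_of_nonneg (Finset.subset_union_right) fun n _ _ => hfre_nonneg n
  linarith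

/-- **The diagonal comb inequalities of an EXACT-cone weight** (`κ = 0`, this item): for `c ≥ 0` exact-feasible
against every Weil test, nonnegative combs `g = Σ_{k∈S} a_k ψ(· − log k)` of a nonnegative real bump, and
finite node sets `T`,
`2 Re Φ(0) · Σ_{n∈T} c(n) n^{-1/2} Σ_{k = nk′} a_k a_{k′} ≤ Re (W_polar + W_arch)(g ⋆ g̃)`. -/
theorem exactWeight_comb_diag_le (hc : ∀ n, 0 ≤ c n)
    (hU0 : ∀ φ : ℝ → ℂ, IsWeilTest φ →
      0 ≤ (weilPolarTerm (weilConv φ (weilReflect φ)) + weilArchTerm (weilConv φ (weilReflect φ)) -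
          ∑' n : ℕ, ((c n : ℝ) : ℂ) / (Real.sqrt n : ℂ) *
            (weilConv φ (weilReflect φ) (Real.log n) + weilConv φ (weilReflect φ) (-Real.log n))).re)
    {ψ : ℝ → ℝ} (hψ : IsWeilTest fun u => (ψ u : ℂ)) (hψ0 : ∀ t, 0 ≤ ψ t)
    (S : Finset ℕ) (hS : ∀ k ∈ S, 0 < k) {a : ℕ → ℝ} (ha : ∀ k, 0 ≤ a k)
    {g : ℝ → ℂ} (hg : g = fun t => ∑ k ∈ S, (a k : ℂ) * weilTranslate (fun u => (ψ u : ℂ)) (Real.log k) t)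
    (T : Finset ℕ) (hT : ∀ n ∈ T, 0 < n) :
    2 * (weilConv (fun u => (ψ u : ℂ)) (weilReflect fun u => (ψ u : ℂ)) 0).re *
        ∑ n ∈ T, c n / Real.sqrt n * ∑ p ∈ (S ×ˢ S).filter (fun p => p.1 = n * p.2), a p.1 * a p.2 ≤
      (weilPolarTerm (weilConv g (weilReflect g)) + weilArchTerm (weilConv g (weilReflect g))).re := by
  have hUκ : ∀ φ : ℝ → ℂ, IsWeilTest φ →
      -((0 : ℝ) * ∫ t, ‖φ t‖ ^ 2) ≤
        (weilPolarTerm (weilConv φ (weilReflect φ)) + weilArchTerm (weilConv φ (weilReflect φ)) -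
          ∑' n : ℕ, ((c n : ℝ) : ℂ) / (Real.sqrt n : ℂ) *
            (weilConv φ (weilReflect φ) (Real.log n) + weilConv φ (weilReflect φ) (-Real.log n))).re := by
    intro φ hφ; rw [zero_mul, neg_zero]; exact hU0 φ hφ
  have h := slackWeight_comb_diag_le hc hUκ hψ hψ0 S hS ha hg T hT
  rwa [zero_mul, add_zero] at h

/-- **The diagonal comb inequalities of a UNIT-SLACK weight** (`κ = 1`, the weights of `ConeMagnification`):
`2 Re Φ(0) · Σ_{n∈T} c(n) n^{-1/2} Σ_{k = nk′} a_k a_{k′} ≤ Re (W_polar + W_arch)(g ⋆ g̃) + ‖g‖₂²`. -/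
theorem unitSlackWeight_comb_diag_le (hc : ∀ n, 0 ≤ c n)
    (hU1 : ∀ φ : ℝ → ℂ, IsWeilTest φ →
      -(∫ t, ‖φ t‖ ^ 2) ≤
        (weilPolarTerm (weilConv φ (weilReflect φ)) + weilArchTerm (weilConv φ (weilReflect φ)) -
          ∑' n : ℕ, ((c n : ℝ) : ℂ) / (Real.sqrt n : ℂ) *
            (weilConv φ (weilReflect φ) (Real.log n) + weilConv φ (weilReflect φ) (-Real.log n))).re)
    {ψ : ℝ → ℝ} (hψ : IsWeilTest fun u => (ψ u : ℂ)) (hψ0 : ∀ t, 0 ≤ ψ t)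
    (S : Finset ℕ) (hS : ∀ k ∈ S, 0 < k) {a : ℕ → ℝ} (ha : ∀ k, 0 ≤ a k)
    {g : ℝ → ℂ} (hg : g = fun t => ∑ k ∈ S, (a k : ℂ) * weilTranslate (fun u => (ψ u : ℂ)) (Real.log k) t)
    (T : Finset ℕ) (hT : ∀ n ∈ T, 0 < n) :
    2 * (weilConv (fun u => (ψ u : ℂ)) (weilReflect fun u => (ψ u : ℂ)) 0).re *
        ∑ n ∈ T, c n / Real.sqrt n * ∑ p ∈ (S ×ˢ S).filter (fun p => p.1 = n * p.2), a p.1 * a p.2 ≤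
      (weilPolarTerm (weilConv g (weilReflect g)) + weilArchTerm (weilConv g (weilReflect g))).re +
        ∫ t, ‖g t‖ ^ 2 := by
  have hUκ : ∀ φ : ℝ → ℂ, IsWeilTest φ →
      -((1 : ℝ) * ∫ t, ‖φ t‖ ^ 2) ≤
        (weilPolarTerm (weilConv φ (weilReflect φ)) + weilArchTerm (weilConv φ (weilReflect φ)) -
          ∑' n : ℕ, ((c n : ℝ) : ℂ) / (Real.sqrt n : ℂ) *
            (weilConv φ (weilReflect φ) (Real.log n) + weilConv φ (weilReflect φ) (-Real.log n))).re := by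
    intro φ hφ; rw [one_mul]; exact hU1 φ hφ
  have h := slackWeight_comb_diag_le hc hUκ hψ hψ0 S hS ha hg T hT
  rwa [one_mul] at h

end Summit.RiemannHypothesis.RiemannHypothesis.Theorems.SignConeExactConeRigidity
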